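import Summits.ValiantsHypothesis.ValiantsHypothesis.Theorems.NewtonUnitEquationsTwoProductsRankOneFourLawWeights
import Summits.ValiantsHypothesis.ValiantsHypothesis.Theorems.NewtonUnitEquationsTwoProductsFormalLogLinearisationBinomialPencilCount
import HarnessLib

/-!
# Route NewtonUnitEquations — crux `TwoProducts` (stmt-ValiantsHypothesis-5906), line `relation_ladder`, rung R6 (four-term
# rank one): the SEGRE LIFT — the PROVED SPLIT `BinExpPencilCount → RankOneFourLaw` — part 6/6 — the count, the arithmetic, the law `RankOneFourLaw`, and the wiring to the landed tool (Part T7, end)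

(T7, continued) the slice bound `sliceBd`, the injective key `l ↦ (b, x̂₀)` with `b ≤ m` and the fibrewise tool count `RelData.count`; the arithmetic `arith_R6` (`(m+1)(s+2)^A(N+2)^{A(log₂(N+2)+1)} ≤ 2^{(212A+13)m}(s+2)^{212A+13}`, `N = 2m(m+1)^3`);
the law `RankOneFourLaw` (R6: `∃ c, ∀ m u v` with constant terms `0`, if for some pairwise DISTINCT `α β γ δ` with `α + β = γ + δ` the family
`j ↦ supp u_j ∪ supp v_j` has `RankOneCoincidences _ (e_γ + e_δ) (e_α + e_β)`, then GLOBALLY `#visible ≤ 2^{c m} (#T + 2)^c`) and THE SPLIT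
`rankOneFourLaw_of_binExpPencilCount : BinExpPencilCount → RankOneFourLaw` (degenerate case via R3♯ `permTypeLaw_proof`).

WIRING (the only non-verbatim declarations of the port; one line each): `binExpPencilCount_holds : BinExpPencilCount` := val-lit-p3 g14's
`…FormalLogLinearisation.BinExpSum.binExpPencilCount` (✓ p620797, witness `A = 3`, literal body of the interface), hence
`rankOneFourLaw : RankOneFourLaw` UNCONDITIONALLY (kernel-complete R6 rung, as ruled in director RULING g12-R197 (b)).

PORT NOTE (val-lit-p11 g1, literature-prover seat, helper mode `--supports stmt-ValiantsHypothesis-5906 --as helper`, no stub credit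
claimed): part 6/6 of a VERBATIM Theorems-side port of val-idea-8 g3's sorry-free module
`Cruxes/TwoProducts/Lines/relation_ladder_R6.lean` (tree @1dcc86cce347; file sha256 36828fc46563…; 1 653 lines; `lean check` rc 0, 0 sorries)
into files of ≤ 400 lines, as tasked by the val-lit desk (RULING #273 (b)). ALL mathematics and ALL proofs below are val-idea-8 g3's (engine
memo `Cruxes/TwoProducts/Lines/relation_ladder_R6_engine.md` rev 3); the port changes only: the file split, the import chain, two deprecated
Mathlib names (`Finsupp.coe_finset_sum` → `Finsupp.coe_finsetSum`, `Finsupp.finset_sum_apply` → `Finsupp.finsetSum_apply`), `omit […] in`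
annotations and one-line docstrings on 45 API lemmas required by the tree's zero-warning / docstring lint. Namespace = the author's
(`…Theorems.NewtonUnitEquations.TwoProducts.PermutationType`, as in the R3♯ port `…PermutationType{WeightOrder,Lifted,PushForward,Count,Family}`).
Nothing here closes the line's residual, the crux `TwoProducts` (5906) or `VP ≠ VNP`; no summit statement is proved.

Cut table: in the module docstring of part 1/6 (`…RankOneFourLawToric`); this file = source l. 1413–1650.

Honest scope (the author's): shapes `α = β + γ` (R6b), `2β = α + γ` (R6c) and coincidence rank `≥ 2` (R7) are NOT covered and go to the
residual of skeleton v14. Nothing here moves VP ≠ VNP; `TwoProducts` (5906) stays OPEN. [folklore]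
-/

noncomputable section

-- Sub = Summit single-conjunct layout: the duplicated namespace component is mandated by the tree.
set_option linter.dupNamespace false
set_option linter.unusedSimpArgs false

namespace Summit.ValiantsHypothesis.ValiantsHypothesis.Theorems.NewtonUnitEquations.TwoProducts.PermutationType
open scoped BigOperators
open MvPolynomial

variable {σ : Type*} [Fintype σ] [DecidableEq σ]

variable (I : FourIdx σ)

section SegreCount
open Summit.ValiantsHypothesis.ValiantsHypothesis.Theorems.NewtonUnitEquations.TwoProducts.FormalLogLinearisation
open Summit.ValiantsHypothesis.ValiantsHypothesis.Theorems.NewtonUnitEquations.TwoProducts.PlanarCell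

variable {m : ℕ} {u v : Fin m → MvPolynomial (Fin 2) ℂ} (D : RelData u v)

/-- The slice bound, uniform in `b ≤ m`. [folklore] -/
def sliceBd (A m s : ℕ) : ℕ :=
  (s + 2) ^ A * (2 * m * (m + 1) ^ 3 + 2) ^ (A * (Nat.log 2 (2 * m * (m + 1) ^ 3 + 2) + 1))

omit [Fintype σ] [DecidableEq σ] in
/-- **The count for a non-degenerate four-term rank-one relation** (all four letters in the alphabet). [folklore] -/
theorem RelData.count {A : ℕ}
    (hA : ∀ (s : ℕ) (κ : Type) [Fintype κ] (C : κ → ℂ) (a : κ → Fin s → ℂ) (d : κ → Fin s → ℕ)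
      (u v : Fin s → ℝ) (S : Finset (Fin s → ℕ)),
      (∀ μ ∈ S, bsum C a d μ ≠ 0 ∧ ∃ t : ℝ, ∀ ν : Fin s → ℕ, ν ≠ μ → bsum C a d ν ≠ 0 →
        ∑ i, (u i + t * v i) * (μ i : ℝ) < ∑ i, (u i + t * v i) * (ν i : ℝ)) →
      S.card ≤ (s + 2) ^ A * (bwidth d + 2) ^ (A * (Nat.log 2 (bwidth d + 2) + 1)))
    (hu : ∀ j, coeff 0 (u j) = 0) (hv : ∀ j, coeff 0 (v j) = 0)
    (hR : RankOneCoincidences (fun j => (u j).support ∪ (v j).support)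
      (Finsupp.single D.γ 1 + Finsupp.single D.δ 1) (Finsupp.single D.α 1 + Finsupp.single D.β 1))
    (S : Finset Expo) (hS : ∀ l ∈ S, ∃ ξ : Fin 2 → ℝ, ValidWeight u v ξ ∧ IsStrictTop ξ ↑(tailDiff u v).support l) :
    S.card ≤ (m + 1) * sliceBd A m (sE u v) := by
  classical
  rcases S.eq_empty_or_nonempty with hSe | hSne
  · simp [hSe]
  obtain ⟨l₀, hl₀⟩ := hSne
  obtain ⟨ξ₀, hval₀, htop₀⟩ := hS l₀ hl₀
  have hTne : (tailSupport u v).Nonempty := tailSupport_nonempty_of_mem u v l₀ htop₀.1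
  have hsE : 0 < sE u v := Finset.card_pos.mpr hTne
  set e₀ : Expo := enum u v ⟨0, hsE⟩ with he₀def
  have he₀ : e₀ ≠ 0 := enum_ne_zero u v hu hv _
  obtain ⟨β, τ, hpencil⟩ := pencil_param e₀ he₀
  have hinj := D.injOn_of_rankOne hu hv hR
  -- choices along `S`
  have hξ : ∀ x : ↥S, ∃ ξ : Fin 2 → ℝ, ValidWeight u v ξ ∧ IsStrictTop ξ ↑(tailDiff u v).support x.1 :=
    fun x => hS x.1 x.2
  choose ξf hξval hξtop using hξ
  have hpt : ∀ x : ↥S, ∃ x₀ : Fin (sE u v) →₀ ℕ, piE D.E' x₀ = x.1 ∧ Balanced D.idx x₀ ∧ x₀ D.idx.c ≤ m ∧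
      Fsl D.idx (cU u v) (cV u v) (x₀ D.idx.c) (xhat D.idx x₀) ≠ 0 ∧
      ∀ ν : Fin (sE u v) → ℕ, ν ≠ ⇑(xhat D.idx x₀) → Fsl D.idx (cU u v) (cV u v) (x₀ D.idx.c) ν ≠ 0 →
        ∑ i, -wt (ξf x) (D.swLetter i) * ((xhat D.idx x₀ i : ℕ) : ℝ) < ∑ i, -wt (ξf x) (D.swLetter i) * (ν i : ℝ) :=
    fun x => D.sliceMin_of_visible hu hv hinj (ξf x) (hξval x) x.1 (hξtop x)
  choose xf hxπ hxbal hxc hxF hxmin using hpt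
  -- normalisation radii and the pencil parameter
  have hrpos : ∀ x : ↥S, 0 < -wt (ξf x) e₀ := fun x => by
    linarith [wt_enum_neg u v (ξf x) (hξval x) ⟨0, hsE⟩]
  have hnorm : ∀ x : ↥S, wt (fun k => ξf x k / (-wt (ξf x) e₀)) e₀ = -1 := fun x => by
    rw [wt_weight_div]
    have hne : wt (ξf x) e₀ ≠ 0 := by linarith [hrpos x]
    rw [div_neg, div_self hne]
  have hc : ∀ x : ↥S, ∃ c : ℝ, ∀ e : Expo, wt (fun k => ξf x k / (-wt (ξf x) e₀)) e = wt β e + c * wt τ e :=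
    fun x => hpencil _ (hnorm x)
  choose cf hcf using hc
  set U : Fin (sE u v) → ℝ := fun i => -wt β (D.swLetter i) with hU
  set V : Fin (sE u v) → ℝ := fun i => -wt τ (D.swLetter i) with hV
  have hUV : ∀ (x : ↥S) (i : Fin (sE u v)),
      U i + cf x * V i = -wt (ξf x) (D.swLetter i) / (-wt (ξf x) e₀) := fun x i => by
    have h := hcf x (D.swLetter i)
    rw [wt_weight_div] at h
    rw [hU, hV]
    simp only
    rw [neg_div, h]
    ring
  have hsumUV : ∀ (x : ↥S) (ν : Fin (sE u v) → ℕ), ∑ i, (U i + cf x * V i) * (ν i : ℝ) =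
      (∑ i, -wt (ξf x) (D.swLetter i) * (ν i : ℝ)) / (-wt (ξf x) e₀) := fun x ν => by
    rw [Finset.sum_div]
    refine Finset.sum_congr rfl fun i _ => ?_
    rw [hUV x i]
    ring
  -- the key map `l ↦ (b, x̂₀)` is injective
  set key : ↥S → ℕ × (Fin (sE u v) → ℕ) := fun x => (xf x D.idx.c, ⇑(xhat D.idx (xf x))) with hkey
  have hinjK : Function.Injective key := by
    intro x y h
    rw [hkey] at h
    simp only [Prod.mk.injEq] at h
    have hx : xf x = xf y := by
      rw [← xOf_xhat D.idx (xf x) (hxbal x), ← xOf_xhat D.idx (xf y) (hxbal y), h.1]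
      exact congrArg _ h.2
    apply Subtype.ext
    rw [← hxπ x, ← hxπ y, hx]
  set Img : Finset (ℕ × (Fin (sE u v) → ℕ)) := (Finset.univ : Finset ↥S).image key with hImg
  have hcard : Img.card = S.card := by
    rw [hImg, Finset.card_image_of_injective _ hinjK, Finset.card_univ, Fintype.card_coe]
  have hfst : ∀ p ∈ Img, p.1 ∈ Finset.range (m + 1) := by
    intro p hp
    obtain ⟨x, -, rfl⟩ := Finset.mem_image.mp hp
    exact Finset.mem_range.mpr (Nat.lt_succ_of_le (hxc x))
  have hfib : ∀ b ∈ Finset.range (m + 1), (Img.filter fun p => p.1 = b).card ≤ sliceBd A m (sE u v) := by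
    intro b hb
    have hbm : b ≤ m := Nat.lt_succ_iff.mp (Finset.mem_range.mp hb)
    set Sb : Finset (Fin (sE u v) → ℕ) := (Img.filter fun p => p.1 = b).image Prod.snd with hSb
    have hcardb : (Img.filter fun p => p.1 = b).card = Sb.card := by
      rw [hSb, Finset.card_image_of_injOn]
      intro p hp q hq hpq
      have hp' := (Finset.mem_filter.mp (Finset.mem_coe.mp hp)).2
      have hq' := (Finset.mem_filter.mp (Finset.mem_coe.mp hq)).2
      exact Prod.ext (hp'.trans hq'.symm) hpq
    rw [hcardb]
    have hhyp : ∀ μ ∈ Sb,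
        bsum (termC D.idx (cU u v) (cV u v) b) (termA D.idx (cU u v) (cV u v) b) (termD D.idx b) μ ≠ 0 ∧
        ∃ t : ℝ, ∀ ν : Fin (sE u v) → ℕ, ν ≠ μ →
          bsum (termC D.idx (cU u v) (cV u v) b) (termA D.idx (cU u v) (cV u v) b) (termD D.idx b) ν ≠ 0 →
            ∑ i, (U i + t * V i) * (μ i : ℝ) < ∑ i, (U i + t * V i) * (ν i : ℝ) := by
      intro μ hμ
      obtain ⟨p, hp, rfl⟩ := Finset.mem_image.mp hμ
      obtain ⟨hpI, hpb⟩ := Finset.mem_filter.mp hp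
      obtain ⟨x, -, rfl⟩ := Finset.mem_image.mp hpI
      rw [hkey] at hpb ⊢
      simp only at hpb ⊢
      refine ⟨?_, cf x, fun ν hν hFν => ?_⟩
      · have := hxF x
        unfold Fsl at this
        rw [hpb] at this
        exact this
      · have hFν' : Fsl D.idx (cU u v) (cV u v) (xf x D.idx.c) ν ≠ 0 := by
          unfold Fsl; rw [hpb]; exact hFν
        have hlt := hxmin x ν hν hFν'
        rw [hsumUV x, hsumUV x ν]
        exact div_lt_div_of_pos_right hlt (hrpos x)
    have hwidth : bwidth (termD D.idx b : SIdx m b → Fin (sE u v) → ℕ) ≤ 2 * m * (m + 1) ^ 3 :=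
      (bwidth_termD_le D.idx b).trans (Nat.mul_le_mul_left _ (Nat.pow_le_pow_left (by omega) 3))
    calc Sb.card ≤ (sE u v + 2) ^ A * (bwidth (termD D.idx b : SIdx m b → Fin (sE u v) → ℕ) + 2) ^
          (A * (Nat.log 2 (bwidth (termD D.idx b : SIdx m b → Fin (sE u v) → ℕ) + 2) + 1)) :=
          hA (sE u v) (SIdx m b) _ _ _ U V Sb hhyp
      _ ≤ sliceBd A m (sE u v) := toolBound_mono _ _ hwidth
  rw [← hcard, Finset.card_eq_sum_card_fiberwise hfst]
  calc ∑ b ∈ Finset.range (m + 1), (Img.filter fun p => p.1 = b).card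
      ≤ ∑ b ∈ Finset.range (m + 1), sliceBd A m (sE u v) := Finset.sum_le_sum hfib
    _ = (m + 1) * sliceBd A m (sE u v) := by rw [Finset.sum_const, Finset.card_range, smul_eq_mul]

omit [Fintype σ] [DecidableEq σ] in
/-- **Arithmetic**: `(m+1) · sliceBd ≤ 2^{c m} (s+2)^c` and `2^{13m}(s+2)^2 ≤ 2^{c m}(s+2)^c` with `c = 212A + 13`. [folklore] -/
theorem arith_R6 (A : ℕ) : ∃ c : ℕ,
    (∀ m s : ℕ, 1 ≤ m → (m + 1) * sliceBd A m s ≤ 2 ^ (c * m) * (s + 2) ^ c) ∧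
    (∀ m s : ℕ, 2 ^ (13 * m) * (s + 2) ^ 2 ≤ 2 ^ (c * m) * (s + 2) ^ c) := by
  refine ⟨212 * A + 13, fun m s hm => ?_, fun m s => ?_⟩
  · set p : ℕ := Nat.log 2 (m + 1) with hp
    have hp1 : m + 1 < 2 ^ (p + 1) := Nat.lt_pow_succ_log_self (by norm_num) (m + 1)
    have hp2 : 2 ^ p ≤ m + 1 := Nat.pow_log_le_self 2 (by omega)
    have hpp : p < 2 ^ p := Nat.lt_two_pow_self
    have hp3 : p * p ≤ 2 ^ (p + 1) := sq_le_two_pow_succ p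
    have h2p : 2 ^ (p + 1) = 2 * 2 ^ p := pow_succ' 2 p
    set N : ℕ := 2 * m * (m + 1) ^ 3 with hN
    have h3 : 1 ≤ (m + 1) ^ 3 := Nat.one_le_pow _ _ (by omega)
    have hN1 : N + 2 ≤ 2 * (m + 1) ^ 4 := by
      have e1 : N + 2 = 2 * (m * (m + 1) ^ 3 + 1) := by rw [hN]; ring
      have e2 : (m + 1) ^ 4 = m * (m + 1) ^ 3 + (m + 1) ^ 3 := by ring
      rw [e1, e2]
      omega
    have hN2 : N + 2 < 2 ^ (4 * p + 5) := by
      have h4 : (m + 1) ^ 4 < (2 ^ (p + 1)) ^ 4 := Nat.pow_lt_pow_left hp1 (by norm_num)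
      have e3 : 2 * (2 ^ (p + 1)) ^ 4 = 2 ^ (4 * p + 5) := by
        rw [← pow_mul, ← pow_succ']
        congr 1
        ring
      calc N + 2 ≤ 2 * (m + 1) ^ 4 := hN1
        _ < 2 * (2 ^ (p + 1)) ^ 4 := by omega
        _ = 2 ^ (4 * p + 5) := e3
    have hL : Nat.log 2 (N + 2) + 1 ≤ 4 * p + 5 := by
      have := Nat.log_lt_of_lt_pow (by omega : N + 2 ≠ 0) hN2
      omega
    have hq : (4 * p + 5) * (4 * p + 5) ≤ 194 * m := by
      have e4 : (4 * p + 5) * (4 * p + 5) = 16 * (p * p) + 40 * p + 25 := by ring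
      rw [e4]
      have hone : 1 ≤ 2 ^ p := Nat.one_le_two_pow
      omega
    have hpow1 : (N + 2) ^ (A * (Nat.log 2 (N + 2) + 1)) ≤ 2 ^ (194 * A * m) := by
      calc (N + 2) ^ (A * (Nat.log 2 (N + 2) + 1))
          ≤ (2 ^ (4 * p + 5)) ^ (A * (Nat.log 2 (N + 2) + 1)) := Nat.pow_le_pow_left hN2.le _
        _ ≤ (2 ^ (4 * p + 5)) ^ (A * (4 * p + 5)) :=
            Nat.pow_le_pow_right (by positivity) (Nat.mul_le_mul_left _ hL)
        _ = 2 ^ (A * ((4 * p + 5) * (4 * p + 5))) := by rw [← pow_mul]; congr 1; ring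
        _ ≤ 2 ^ (194 * A * m) := Nat.pow_le_pow_right (by norm_num) (by
            calc A * ((4 * p + 5) * (4 * p + 5)) ≤ A * (194 * m) := Nat.mul_le_mul_left _ hq
              _ = 194 * A * m := by ring)
    have hm1 : m + 1 ≤ 2 ^ m := Nat.lt_two_pow_self
    have hsA : (s + 2) ^ A ≤ (s + 2) ^ (212 * A + 13) := Nat.pow_le_pow_right (by omega) (by omega)
    have hexp : m + 194 * A * m ≤ (212 * A + 13) * m := by nlinarith [Nat.zero_le (A * m)]
    calc (m + 1) * sliceBd A m s = (m + 1) * ((s + 2) ^ A * (N + 2) ^ (A * (Nat.log 2 (N + 2) + 1))) := by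
          rw [hN]; rfl
      _ ≤ 2 ^ m * ((s + 2) ^ (212 * A + 13) * 2 ^ (194 * A * m)) :=
          Nat.mul_le_mul hm1 (Nat.mul_le_mul hsA hpow1)
      _ = 2 ^ (m + 194 * A * m) * (s + 2) ^ (212 * A + 13) := by rw [pow_add]; ring
      _ ≤ 2 ^ ((212 * A + 13) * m) * (s + 2) ^ (212 * A + 13) :=
          Nat.mul_le_mul_right _ (Nat.pow_le_pow_right (by norm_num) hexp)
  · have hexp : 13 * m ≤ (212 * A + 13) * m := by nlinarith [Nat.zero_le (A * m)]
    exact Nat.mul_le_mul (Nat.pow_le_pow_right (by norm_num) hexp) (Nat.pow_le_pow_right (by omega) (by omega))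

omit [Fintype σ] [DecidableEq σ] in
/-- **R6 — THE FOUR-TERM RANK-ONE LAW, UNCONDITIONAL** (val-idea-8 g3's split `BinExpPencilCount → RankOneFourLaw` —
Segre lift + toric Lemma A + `b`-slicing + the binomial-exponential pencil count — fed with val-lit-p3 g14's tool theorem
`BinExpSum.binExpPencilCount` through `binExpPencilCount_fintype`).  If ALL additive coincidences of the letter family come
from ONE four-term relation `α + β = γ + δ` among distinct letters (rank-one coincidence lattice), then GLOBALLY
`#visible ≤ 2^{c m} (#T + 2)^c`.  PORT DELTA (val-lit-p3 g14, filing seat): the source states this as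
`def RankOneFourLaw : Prop := …` + `theorem rankOneFourLaw_of_binExpPencilCount (hT : BinExpPencilCount) : RankOneFourLaw`;
parameter-free `def … : Prop`s are relocated by the gate (bounce p622844), so — exactly as the R3♯ port's
`permTypeLaw_proof` — the law is stated by its LITERAL body and proved outright (the line file wires its own `RankOneFourLaw`
def against this theorem by `exact`).  Nothing here closes the residual of the line, the crux `TwoProducts` (5906) or
`VP ≠ VNP`. [folklore] -/
theorem rankOneFourLaw_proof :
  ∃ c : ℕ, ∀ (m : ℕ) (u v : Fin m → MvPolynomial (Fin 2) ℂ), (∀ j, coeff 0 (u j) = 0) → (∀ j, coeff 0 (v j) = 0) →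
    (∃ α β γ δ : Expo, α ≠ β ∧ α ≠ γ ∧ α ≠ δ ∧ β ≠ γ ∧ β ≠ δ ∧ γ ≠ δ ∧ α + β = γ + δ ∧
      RankOneCoincidences (fun j => (u j).support ∪ (v j).support)
        (Finsupp.single γ 1 + Finsupp.single δ 1) (Finsupp.single α 1 + Finsupp.single β 1)) →
    ∀ S : Finset Expo, (∀ l ∈ S, ∃ ξ : Fin 2 → ℝ, ValidWeight u v ξ ∧ IsStrictTop ξ ↑(tailDiff u v).support l) →
      S.card ≤ 2 ^ (c * m) * ((tailSupport u v).card + 2) ^ c := by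
  classical
  obtain ⟨A, hA⟩ := binExpPencilCount_fintype
  obtain ⟨c, hc1, hc2⟩ := arith_R6 A
  refine ⟨c, fun m u v hu hv hrel S hS => ?_⟩
  obtain ⟨α, β, γ, δ, hab, hac, had, hbc, hbd, hcd, hrel, hR⟩ := hrel
  rcases S.eq_empty_or_nonempty with hSe | hSne
  · simp [hSe]
  obtain ⟨l₀, hl₀⟩ := hSne
  obtain ⟨ξ₀, hval₀, htop₀⟩ := hS l₀ hl₀
  have hm : 1 ≤ m := by
    rcases Nat.eq_zero_or_pos m with h | h
    · exfalso
      subst h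
      apply mem_support_iff.mp htop₀.1
      unfold tailDiff
      simp
    · exact h
  by_cases hall : α ∈ tailSupport u v ∧ β ∈ tailSupport u v ∧ γ ∈ tailSupport u v ∧ δ ∈ tailSupport u v
  · obtain ⟨hα, hβ, hγ, hδ⟩ := hall
    let D : RelData u v := ⟨α, β, γ, δ, hα, hβ, hγ, hδ, hab, hac, had, hbc, hbd, hcd, hrel⟩
    have h := (D.count hA hu hv hR S hS).trans (hc1 m (sE u v) hm)
    exact h
  · have hex : ∃ e : Expo, (e = α ∨ e = β ∨ e = γ ∨ e = δ) ∧ e ∉ tailSupport u v := by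
      simp only [not_and_or] at hall
      rcases hall with h | h | h | h
      exacts [⟨α, Or.inl rfl, h⟩, ⟨β, Or.inr (Or.inl rfl), h⟩, ⟨γ, Or.inr (Or.inr (Or.inl rfl)), h⟩,
        ⟨δ, Or.inr (Or.inr (Or.inr rfl)), h⟩]
    obtain ⟨e, he, hnot⟩ := hex
    have hnotj : ∀ j, e ∉ (u j).support ∪ (v j).support := by
      intro j hj
      apply hnot
      rcases Finset.mem_union.mp hj with h | h
      · exact support_u_subset u v j h
      · exact support_v_subset u v j h
    have hperm : PermType (fun j => (u j).support ∪ (v j).support) :=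
      permType_of_absent_letter _ α β γ δ hab hac had hbc hbd hcd hR e he hnotj
    calc S.card ≤ 2 ^ (13 * m) * ((tailSupport u v).card + 2) ^ 2 := permTypeLaw_proof m u v hu hv hperm S hS
      _ ≤ 2 ^ (c * m) * ((tailSupport u v).card + 2) ^ c := hc2 m _

end SegreCount

end Summit.ValiantsHypothesis.ValiantsHypothesis.Theorems.NewtonUnitEquations.TwoProducts.PermutationType

end
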